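import Mathlib.Geometry.Manifold.VectorField.LieBracket
import Literature.Geometry.Lorentzian.IsometryProofs
import Literature.Geometry.Lorentzian.ChartCalculus
import Literature.Geometry.Lorentzian.LeviCivitaProofs
import Literature.Geometry.Lorentzian.CurvatureSymmetries
import HarnessLib

/-!
# Naturality of the Levi-Civita connection under local diffeomorphisms

Support file (all results proved) for Bartnik's existence theorem for the ADM energy
(`Literature.Geometry.Lorentzian.AFEnd.HasADMEnergy_of_isAsymptoticallyFlat`), whose proof reads
the scalar curvature of the data in the chart of the asymptotically flat end, i.e. transports
curvature along the (inverse) chart `Φ : {R < ‖x‖} → X`.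

Let `Φ : N → M` be a smooth map between manifolds of the same dimension all of whose
differentials are injective (a local diffeomorphism; no inverse of `Φ` is needed), `g` a smooth
pseudo-Riemannian metric on `M` and `Φ^* g` the pullback metric on `N`
(`PseudoRiemannianMetric.comap`, file `Isometry`). For a vector field `Y` on `M` write
`Φ^* Y = mpullback Φ Y`, `(Φ^* Y)_u = (dΦ_u)⁻¹ Y_{Φ u}` (Mathlib). We prove:

* `koszulFunctional_comap_mpullback` — the Koszul functional is natural:
  `K_{Φ^*g}(Φ^*X, Φ^*Y, Φ^*Z)(u) = K_g(X, Y, Z)(Φ u)` (chain rule for the three derivative terms,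
  Mathlib's `mpullback_mlieBracket` for the three bracket terms);
* `leviCivita_comap_mpullback_apply` — **naturality of the Levi-Civita connection**:
  `∇^{Φ^*g}_v (Φ^*Y) (u) = (dΦ_u)⁻¹ (∇^g_{dΦ_u v} Y)(Φ u)` for `Y` differentiable at `Φ u`
  (O'Neill 1983, Ch. 3, Prop. 3.59 for isometries; here from the Koszul characterisation
  `leviCivita_eq_of_forall`, tensoriality of the Koszul functional in its outer slots, and the
  naturality above).

Regularity: the statements are proved for a `C^n` metric, `n ≥ 1`, and a `C^{n+1}` map `Φ`
(suffix `_cn`: `val_comap_mpullback_cn`, `koszulFunctional_comap_mpullback_cn`,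
`leviCivita_comap_mpullback_cn`, `…_apply_cn`, `…_mpullback_cn`; the Koszul formula
`two_mul_val_leviCivita_apply_holds` holds for `C^n` metrics, `n ≥ 1`, and `C^k` fields pull back to
`C^k` fields along `C^{k+1}` maps); the `C^∞` statements (original names, unchanged signatures)
are their specialisations `n = ∞`. The finite-regularity case serves `C²` conformal
compactifications `ḡ = ρ² g⁺` pulled back along the interior embedding (Li–Qing–Shi 2017,
Def. 2.1, Lemma 1.6).

The curvature tensors are treated in `CurvatureNaturality.lean`.

## References

* B. O'Neill, *Semi-Riemannian geometry* (1983), Ch. 3, Thm. 3.11 (Koszul formula),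
  Prop. 3.59 and Cor. 3.60–3.61 (isometries preserve the Levi-Civita connection), pp. 90–91
  (local isometries).
* J. M. Lee, *Introduction to Riemannian Manifolds* (2018), Prop. 5.13 (naturality of the
  Levi-Civita connection).
-/

noncomputable section

open Bundle Set Function Filter FiberBundle VectorField ContinuousLinearMap
open scoped Manifold ContDiff Topology

namespace Literature.Geometry.Lorentzian

namespace PseudoRiemannianMetric

section Helpers

variable {E : Type*} [NormedAddCommGroup E] [NormedSpace ℝ E] {H : Type*} [TopologicalSpace H]
  {I : ModelWithCorners ℝ E H} {M : Type*} [TopologicalSpace M] [ChartedSpace H M]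
  [IsManifold I ∞ M]
  {E' : Type*} [NormedAddCommGroup E'] [NormedSpace ℝ E'] {H' : Type*} [TopologicalSpace H']
  {I' : ModelWithCorners ℝ E' H'} {N : Type*} [TopologicalSpace N] [ChartedSpace H' N]
  [IsManifold I' ∞ N]
  [FiniteDimensional ℝ E] [FiniteDimensional ℝ E']
  {Φ : N → M} (hΦ' : ∀ u, Function.Injective (mfderiv I' I Φ u))
  (hdim : Module.finrank ℝ E' = Module.finrank ℝ E)

/-! ### The differential of an equidimensional immersion is invertible -/

omit [IsManifold I ∞ M] [IsManifold I' ∞ N] in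
include hdim in
/-- All differentials of an equidimensional immersion are invertible continuous linear maps
(rank–nullity, `mfderivEquivOfInjective`, and automatic continuity in finite dimension).
O'Neill 1983, Ch. 1, Lemma 1.31. [cite: ONeill1983, Ch. 1, Lemma 1.31] -/
theorem isInvertible_mfderiv_of_injective {u : N} (hu : Function.Injective (mfderiv I' I Φ u)) :
    (mfderiv I' I Φ u).IsInvertible := by
  haveI : FiniteDimensional ℝ (TangentSpace I' u) := inferInstanceAs (FiniteDimensional ℝ E')
  haveI : FiniteDimensional ℝ (TangentSpace I (Φ u)) := inferInstanceAs (FiniteDimensional ℝ E)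
  haveI : T2Space (TangentSpace I' u) := inferInstanceAs (T2Space E')
  haveI : T2Space (TangentSpace I (Φ u)) := inferInstanceAs (T2Space E)
  refine ⟨(mfderivEquivOfInjective (I := I) (I' := I') Φ u hu hdim).toContinuousLinearEquiv, ?_⟩
  ext v
  rfl

omit [IsManifold I ∞ M] [IsManifold I' ∞ N] in
include hΦ' hdim in
/-- `dΦ_u (Φ^* Y)_u = Y_{Φ u}`: the pulled-back field is mapped back by the differential.
[folklore] -/
theorem mfderiv_mpullback_apply (Y : Π x : M, TangentSpace I x) (u : N) :
    mfderiv I' I Φ u (mpullback I' I Φ Y u) = Y (Φ u) := by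
  rw [mpullback_apply]
  exact (isInvertible_mfderiv_of_injective hdim (hΦ' u)).self_apply_inverse _

omit [IsManifold I' ∞ N] in
include hΦ' hdim in
/-- The pullback of the canonical extension of `dΦ_u X₀` takes the value `X₀` at `u`. [folklore] -/
theorem mpullback_extend_mfderiv_apply (u : N) (X₀ : TangentSpace I' u) :
    mpullback I' I Φ (FiberBundle.extend E (mfderiv I' I Φ u X₀)) u = X₀ := by
  rw [mpullback_apply, FiberBundle.extend_apply_self]
  exact (isInvertible_mfderiv_of_injective hdim (hΦ' u)).inverse_apply_self _

omit [IsManifold I ∞ M] [IsManifold I' ∞ N] [FiniteDimensional ℝ E] [FiniteDimensional ℝ E'] in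
/-- **Chain rule for `mvfderiv`**: `d(f ∘ Φ)_u v = df_{Φ u} (dΦ_u v)` for a scalar- (or vector-)
valued `f`. [folklore] -/
theorem mvfderiv_comp_apply {F : Type*} [NormedAddCommGroup F] [NormedSpace ℝ F] {f : M → F}
    {u : N} (hf : MDifferentiableAt I 𝓘(ℝ, F) f (Φ u)) (hΦu : MDifferentiableAt I' I Φ u)
    (v : TangentSpace I' u) :
    mvfderiv I' (f ∘ Φ) u v = mvfderiv I f (Φ u) (mfderiv I' I Φ u v) := by
  simp only [mvfderiv, ContinuousLinearMap.comp_apply]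
  rw [mfderiv_comp u hf hΦu]
  rfl

end Helpers

/-! ### Naturality of the Koszul functional and of the Levi-Civita connection: `C^n` metric, `n ≥ 1` -/

section Cn

variable {E : Type*} [NormedAddCommGroup E] [NormedSpace ℝ E] {H : Type*} [TopologicalSpace H]
  {I : ModelWithCorners ℝ E H} {M : Type*} [TopologicalSpace M] [ChartedSpace H M]
  [IsManifold I ∞ M]
  {E' : Type*} [NormedAddCommGroup E'] [NormedSpace ℝ E'] {H' : Type*} [TopologicalSpace H']
  {I' : ModelWithCorners ℝ E' H'} {N : Type*} [TopologicalSpace N] [ChartedSpace H' N]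
  [IsManifold I' ∞ N]
  [FiniteDimensional ℝ E] [FiniteDimensional ℝ E']
  {n : ℕ∞ω} [Fact (1 ≤ n)]
  (g : PseudoRiemannianMetric I n E (TangentSpace I : M → Type _))
  {Φ : N → M} (hpb : contMDiff_pullbackBilin I M I' N n) (hΦ : ContMDiff I' I (n + 1) Φ)
  (hΦ' : ∀ u, Function.Injective (mfderiv I' I Φ u))
  (hdim : Module.finrank ℝ E' = Module.finrank ℝ E)


omit [Fact (1 ≤ n)] in
include hΦ' in
/-- The pullback metric pairs pulled-back fields as `g` pairs the fields:
`(Φ^*g)_u ((Φ^*Y)_u, (Φ^*Z)_u) = g_{Φ u} (Y_{Φ u}, Z_{Φ u})` (any regularity). [folklore] -/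
theorem val_comap_mpullback_cn (Y Z : Π x : M, TangentSpace I x) (u : N) :
    (g.comap hpb Φ hΦ hΦ' hdim).val u (mpullback I' I Φ Y u) (mpullback I' I Φ Z u) =
      g.val (Φ u) (Y (Φ u)) (Z (Φ u)) := by
  rw [val_comap, pullbackBilin_apply, mfderiv_mpullback_apply hΦ' hdim,
    mfderiv_mpullback_apply hΦ' hdim]

include hΦ' in
/-- **Naturality of the Koszul functional, `C^n` metric, `n ≥ 1`, `C^{n+1}` map `Φ`.** For vector
fields `X, Y, Z` on `M` differentiable at `Φ u`, `K_{Φ^*g}(Φ^*X, Φ^*Y, Φ^*Z)(u) = K_g(X, Y, Z)(Φ u)`: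
the three derivative terms by the chain rule (the paired functions are `g(Y, Z) ∘ Φ` etc.), the
three bracket terms by naturality of the Lie bracket (`mpullback_mlieBracket`). O'Neill 1983,
Ch. 3, proof of Prop. 3.59. [cite: ONeill1983, Ch. 3, Prop. 3.59] -/
theorem koszulFunctional_comap_mpullback_cn {u : N} {X Y Z : Π x : M, TangentSpace I x}
    (hX : MDiffAt (T% X) (Φ u)) (hY : MDiffAt (T% Y) (Φ u)) (hZ : MDiffAt (T% Z) (Φ u)) :
    (g.comap hpb Φ hΦ hΦ' hdim).koszulFunctional (mpullback I' I Φ X) (mpullback I' I Φ Y)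
        (mpullback I' I Φ Z) u = g.koszulFunctional X Y Z (Φ u) := by
  have h1n : (1 : ℕ∞ω) ≤ n := Fact.out
  have hΦu : MDifferentiableAt I' I Φ u :=
    (hΦ u).mdifferentiableAt (one_pos.trans_le le_add_self).ne'
  have hmin : minSmoothness ℝ 2 ≤ n + 1 := by
    rw [minSmoothness_of_isRCLikeNormedField]
    calc (2 : ℕ∞ω) = 1 + 1 := by norm_num
      _ ≤ n + 1 := add_le_add h1n le_rfl
  haveI : IsManifold I' (minSmoothness ℝ 2) N := by
    rw [minSmoothness_of_isRCLikeNormedField]; infer_instance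
  haveI : IsManifold I (minSmoothness ℝ 2) M := by
    rw [minSmoothness_of_isRCLikeNormedField]; infer_instance
  -- the paired functions are pulled back along `Φ`
  have hval : ∀ A B : Π x : M, TangentSpace I x,
      (fun u' ↦ (g.comap hpb Φ hΦ hΦ' hdim).val u' (mpullback I' I Φ A u')
        (mpullback I' I Φ B u')) = (fun x ↦ g.val x (A x) (B x)) ∘ Φ := by
    intro A B
    funext u'
    exact val_comap_mpullback_cn g hpb hΦ hΦ' hdim A B u'
  -- the derivative terms
  have hder : ∀ {A B C : Π x : M, TangentSpace I x}, MDiffAt (T% A) (Φ u) → MDiffAt (T% B) (Φ u) →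
      mvfderiv I' (fun u' ↦ (g.comap hpb Φ hΦ hΦ' hdim).val u' (mpullback I' I Φ A u')
        (mpullback I' I Φ B u')) u (mpullback I' I Φ C u) =
      mvfderiv I (fun x ↦ g.val x (A x) (B x)) (Φ u) (C (Φ u)) := by
    intro A B C hA hB
    rw [hval A B, mvfderiv_comp_apply (g.mdifferentiableAt_val_apply hA hB) hΦu,
      mfderiv_mpullback_apply hΦ' hdim]
  -- the bracket terms
  have hbr : ∀ {A B C : Π x : M, TangentSpace I x}, MDiffAt (T% A) (Φ u) → MDiffAt (T% B) (Φ u) →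
      (g.comap hpb Φ hΦ hΦ' hdim).val u (mpullback I' I Φ C u)
        (mlieBracket I' (mpullback I' I Φ A) (mpullback I' I Φ B) u) =
      g.val (Φ u) (C (Φ u)) (mlieBracket I A B (Φ u)) := by
    intro A B C hA hB
    rw [← mpullback_mlieBracket hA hB (hΦ u) hmin]
    exact val_comap_mpullback_cn g hpb hΦ hΦ' hdim C (mlieBracket I A B) u
  simp only [koszulFunctional]
  rw [hder hY hZ, hder hZ hX, hder hX hY, hbr hY hZ, hbr hZ hX, hbr hX hY]

include hΦ' in
/-- **Naturality of the Levi-Civita connection under local diffeomorphisms, `C^n` metric,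
`n ≥ 1`** (O'Neill 1983, Ch. 3, Prop. 3.59 / Cor. 3.61, stated there for isometries; Lee 2018,
Prop. 5.13): for a `C^{n+1}` equidimensional immersion `Φ : N → M`, a `C^n` metric `g` on `M` and a
vector field `Y` on `M` differentiable at `Φ u`,
`(∇^{Φ^*g} (Φ^*Y))_u = (dΦ_u)⁻¹ ∘ (∇^g Y)_{Φ u} ∘ dΦ_u`,
i.e. `∇^{Φ^*g}_v (Φ^*Y) = (dΦ_u)⁻¹ ∇^g_{dΦ_u v} Y`. Proof: the right-hand side satisfies the
Koszul identity characterising `(∇^{Φ^*g}(Φ^*Y))_u` (`leviCivita_eq_of_forall`), because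
`(Φ^*g)_u((dΦ)⁻¹ ∇_{dΦ X₀} Y, Z₀) = g(∇_{dΦ X₀} Y, dΦ Z₀)`, which by the Koszul formula on `M`
is `K_g` on the extensions of `dΦ X₀, dΦ Z₀`, which by naturality of `K` and tensoriality in the
outer slots is `K_{Φ^*g}` on the extensions of `X₀, Z₀`. [cite: ONeill1983, Ch. 3, Prop. 3.59] -/
theorem leviCivita_comap_mpullback_cn [g.HasLeviCivita] [(g.comap hpb Φ hΦ hΦ' hdim).HasLeviCivita]
    {u : N} {Y : Π x : M, TangentSpace I x} (hY : MDiffAt (T% Y) (Φ u)) :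
    (g.comap hpb Φ hΦ hΦ' hdim).leviCivita (mpullback I' I Φ Y) u =
      ((mfderiv I' I Φ u).inverse ∘L g.leviCivita Y (Φ u)) ∘L mfderiv I' I Φ u := by
  have h1n : (1 : ℕ∞ω) ≤ n := Fact.out
  have hinv : ∀ u', (mfderiv I' I Φ u').IsInvertible := fun u' ↦
    isInvertible_mfderiv_of_injective hdim (hΦ' u')
  -- pulled-back fields are differentiable at `u`
  have h2 : (2 : ℕ∞ω) ≤ n + 1 := by
    calc (2 : ℕ∞ω) = 1 + 1 := by norm_num
      _ ≤ n + 1 := add_le_add h1n le_rfl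
  have hpull : ∀ {A : Π x : M, TangentSpace I x}, MDiffAt (T% A) (Φ u) →
      MDiffAt (T% (mpullback I' I Φ A)) u := fun hA ↦
    hA.mpullback_vectorField (hΦ u) (hinv u) h2
  refine (g.comap hpb Φ hΦ hΦ' hdim).leviCivita_eq_of_forall _ fun X₀ Z₀ ↦ ?_
  -- left-hand side: the Koszul formula on `M` at the extensions of `dΦ X₀`, `dΦ Z₀`
  set X' : Π x : M, TangentSpace I x := FiberBundle.extend E (mfderiv I' I Φ u X₀) with hX'
  set Z' : Π x : M, TangentSpace I x := FiberBundle.extend E (mfderiv I' I Φ u Z₀) with hZ'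
  have hX'd : MDiffAt (T% X') (Φ u) := mdifferentiableAt_extend ..
  have hZ'd : MDiffAt (T% Z') (Φ u) := mdifferentiableAt_extend ..
  have lhs : 2 * (g.comap hpb Φ hΦ hΦ' hdim).val u
      ((((mfderiv I' I Φ u).inverse ∘L g.leviCivita Y (Φ u)) ∘L mfderiv I' I Φ u) X₀) Z₀ =
      g.koszulFunctional X' Y Z' (Φ u) := by
    rw [val_comap, pullbackBilin_apply, ContinuousLinearMap.comp_apply,
      ContinuousLinearMap.comp_apply, (hinv u).self_apply_inverse]
    have h := g.two_mul_val_leviCivita_apply_holds hX'd hY hZ'd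
    rw [hX', hZ', FiberBundle.extend_apply_self, FiberBundle.extend_apply_self] at h
    rw [← hX', ← hZ'] at h
    exact h
  rw [lhs]
  -- right-hand side: tensoriality in the outer slots, then naturality of `K`
  have hXp : MDiffAt (T% (mpullback I' I Φ X')) u := hpull hX'd
  have hZp : MDiffAt (T% (mpullback I' I Φ Z')) u := hpull hZ'd
  have hYp : MDiffAt (T% (mpullback I' I Φ Y)) u := hpull hY
  have key := (g.comap hpb Φ hΦ hΦ' hdim).koszulFunctional_apply_eq_extend hXp hYp hZp
  rw [hX', mpullback_extend_mfderiv_apply hΦ' hdim, ← hX'] at key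
  rw [hZ', mpullback_extend_mfderiv_apply hΦ' hdim, ← hZ'] at key
  rw [← key]
  exact (g.koszulFunctional_comap_mpullback_cn hpb hΦ hΦ' hdim hX'd hY hZ'd).symm

include hΦ' in
/-- Pointwise form of `leviCivita_comap_mpullback_cn` (`C^n` metric, `n ≥ 1`):
`∇^{Φ^*g}_v (Φ^*Y) (u) = (dΦ_u)⁻¹ (∇^g_{dΦ_u v} Y (Φ u))`. [cite: ONeill1983, Ch. 3, Prop. 3.59] -/
theorem leviCivita_comap_mpullback_apply_cn [g.HasLeviCivita]
    [(g.comap hpb Φ hΦ hΦ' hdim).HasLeviCivita] {u : N} {Y : Π x : M, TangentSpace I x}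
    (hY : MDiffAt (T% Y) (Φ u)) (v : TangentSpace I' u) :
    (g.comap hpb Φ hΦ hΦ' hdim).leviCivita (mpullback I' I Φ Y) u v =
      (mfderiv I' I Φ u).inverse (g.leviCivita Y (Φ u) (mfderiv I' I Φ u v)) := by
  rw [g.leviCivita_comap_mpullback_cn hpb hΦ hΦ' hdim hY]
  rfl

include hΦ' in
/-- **The covariant derivative along a pulled-back field is the pullback of the covariant
derivative** (`C^n` metric, `n ≥ 1`): for `W, Y` differentiable at `Φ u`,
`∇^{Φ^*g}_{Φ^*W} (Φ^*Y) (u) = (Φ^*(∇^g_W Y))(u)`, where `∇^g_W Y` denotes the field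
`x ↦ (∇^g Y)_x (W x)`. [cite: ONeill1983, Ch. 3, Prop. 3.59] -/
theorem leviCivita_comap_mpullback_mpullback_cn [g.HasLeviCivita]
    [(g.comap hpb Φ hΦ hΦ' hdim).HasLeviCivita] {u : N} {W Y : Π x : M, TangentSpace I x}
    (hY : MDiffAt (T% Y) (Φ u)) :
    (g.comap hpb Φ hΦ hΦ' hdim).leviCivita (mpullback I' I Φ Y) u (mpullback I' I Φ W u) =
      mpullback I' I Φ (fun x ↦ g.leviCivita Y x (W x)) u := by
  rw [g.leviCivita_comap_mpullback_apply_cn hpb hΦ hΦ' hdim hY, mfderiv_mpullback_apply hΦ' hdim,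
    mpullback_apply]

end Cn

/-! ### The `C^∞` statements (specialisations `n = ∞`) -/

section Smooth

variable {E : Type*} [NormedAddCommGroup E] [NormedSpace ℝ E] {H : Type*} [TopologicalSpace H]
  {I : ModelWithCorners ℝ E H} {M : Type*} [TopologicalSpace M] [ChartedSpace H M]
  [IsManifold I ∞ M]
  {E' : Type*} [NormedAddCommGroup E'] [NormedSpace ℝ E'] {H' : Type*} [TopologicalSpace H']
  {I' : ModelWithCorners ℝ E' H'} {N : Type*} [TopologicalSpace N] [ChartedSpace H' N]
  [IsManifold I' ∞ N]
  [FiniteDimensional ℝ E] [FiniteDimensional ℝ E']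
  (g : PseudoRiemannianMetric I ∞ E (TangentSpace I : M → Type _))
  {Φ : N → M} (hpb : contMDiff_pullbackBilin I M I' N ∞) (hΦ : ContMDiff I' I (∞ + 1) Φ)
  (hΦ' : ∀ u, Function.Injective (mfderiv I' I Φ u))
  (hdim : Module.finrank ℝ E' = Module.finrank ℝ E)

include hΦ' in
/-- The pullback metric pairs pulled-back fields as `g` pairs the fields:
`(Φ^*g)_u ((Φ^*Y)_u, (Φ^*Z)_u) = g_{Φ u} (Y_{Φ u}, Z_{Φ u})`. [folklore] -/
theorem val_comap_mpullback (Y Z : Π x : M, TangentSpace I x) (u : N) :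
    (g.comap hpb Φ hΦ hΦ' hdim).val u (mpullback I' I Φ Y u) (mpullback I' I Φ Z u) =
      g.val (Φ u) (Y (Φ u)) (Z (Φ u)) :=
  val_comap_mpullback_cn g hpb hΦ hΦ' hdim Y Z u

include hΦ' in
/-- **Naturality of the Koszul functional.** For vector fields `X, Y, Z` on `M` differentiable at
`Φ u`, `K_{Φ^*g}(Φ^*X, Φ^*Y, Φ^*Z)(u) = K_g(X, Y, Z)(Φ u)`: the three derivative terms by the
chain rule (the paired functions are `g(Y, Z) ∘ Φ` etc.), the three bracket terms by naturality of
the Lie bracket (`mpullback_mlieBracket`). O'Neill 1983, Ch. 3, proof of Prop. 3.59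
(`koszulFunctional_comap_mpullback_cn` at `n = ∞`). [cite: ONeill1983, Ch. 3, Prop. 3.59] -/
theorem koszulFunctional_comap_mpullback {u : N} {X Y Z : Π x : M, TangentSpace I x}
    (hX : MDiffAt (T% X) (Φ u)) (hY : MDiffAt (T% Y) (Φ u)) (hZ : MDiffAt (T% Z) (Φ u)) :
    (g.comap hpb Φ hΦ hΦ' hdim).koszulFunctional (mpullback I' I Φ X) (mpullback I' I Φ Y)
        (mpullback I' I Φ Z) u = g.koszulFunctional X Y Z (Φ u) :=
  koszulFunctional_comap_mpullback_cn g hpb hΦ hΦ' hdim hX hY hZ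

include hΦ' in
/-- **Naturality of the Levi-Civita connection under local diffeomorphisms** (O'Neill 1983,
Ch. 3, Prop. 3.59 / Cor. 3.61, stated there for isometries; Lee 2018, Prop. 5.13): for a smooth
equidimensional immersion `Φ : N → M`, a smooth metric `g` on `M` and a vector field `Y` on `M`
differentiable at `Φ u`,
`(∇^{Φ^*g} (Φ^*Y))_u = (dΦ_u)⁻¹ ∘ (∇^g Y)_{Φ u} ∘ dΦ_u`,
i.e. `∇^{Φ^*g}_v (Φ^*Y) = (dΦ_u)⁻¹ ∇^g_{dΦ_u v} Y` (`leviCivita_comap_mpullback_cn` at `n = ∞`).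
[cite: ONeill1983, Ch. 3, Prop. 3.59] -/
theorem leviCivita_comap_mpullback [g.HasLeviCivita] [(g.comap hpb Φ hΦ hΦ' hdim).HasLeviCivita]
    {u : N} {Y : Π x : M, TangentSpace I x} (hY : MDiffAt (T% Y) (Φ u)) :
    (g.comap hpb Φ hΦ hΦ' hdim).leviCivita (mpullback I' I Φ Y) u =
      ((mfderiv I' I Φ u).inverse ∘L g.leviCivita Y (Φ u)) ∘L mfderiv I' I Φ u :=
  leviCivita_comap_mpullback_cn g hpb hΦ hΦ' hdim hY

include hΦ' in
/-- Pointwise form of `leviCivita_comap_mpullback`: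
`∇^{Φ^*g}_v (Φ^*Y) (u) = (dΦ_u)⁻¹ (∇^g_{dΦ_u v} Y (Φ u))`. [cite: ONeill1983, Ch. 3, Prop. 3.59] -/
theorem leviCivita_comap_mpullback_apply [g.HasLeviCivita]
    [(g.comap hpb Φ hΦ hΦ' hdim).HasLeviCivita] {u : N} {Y : Π x : M, TangentSpace I x}
    (hY : MDiffAt (T% Y) (Φ u)) (v : TangentSpace I' u) :
    (g.comap hpb Φ hΦ hΦ' hdim).leviCivita (mpullback I' I Φ Y) u v =
      (mfderiv I' I Φ u).inverse (g.leviCivita Y (Φ u) (mfderiv I' I Φ u v)) :=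
  leviCivita_comap_mpullback_apply_cn g hpb hΦ hΦ' hdim hY v

include hΦ' in
/-- **The covariant derivative along a pulled-back field is the pullback of the covariant
derivative**: for `W, Y` differentiable at `Φ u`,
`∇^{Φ^*g}_{Φ^*W} (Φ^*Y) (u) = (Φ^*(∇^g_W Y))(u)`, where `∇^g_W Y` denotes the field
`x ↦ (∇^g Y)_x (W x)`. [cite: ONeill1983, Ch. 3, Prop. 3.59] -/
theorem leviCivita_comap_mpullback_mpullback [g.HasLeviCivita]
    [(g.comap hpb Φ hΦ hΦ' hdim).HasLeviCivita] {u : N} {W Y : Π x : M, TangentSpace I x}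
    (hY : MDiffAt (T% Y) (Φ u)) :
    (g.comap hpb Φ hΦ hΦ' hdim).leviCivita (mpullback I' I Φ Y) u (mpullback I' I Φ W u) =
      mpullback I' I Φ (fun x ↦ g.leviCivita Y x (W x)) u :=
  leviCivita_comap_mpullback_mpullback_cn g hpb hΦ hΦ' hdim hY

end Smooth

end PseudoRiemannianMetric

end Literature.Geometry.Lorentzian

end
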